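import Mathlib
import HarnessLib
import Summits.ResolutionOfSingularities.ResolutionOfSingularities.Theorems.HomologicalConductorPersistenceKC3WitnessTransport
import Summits.ResolutionOfSingularities.ResolutionOfSingularities.Theorems.HomologicalConductorPersistenceKC3ChartClosedForm
import Summits.ResolutionOfSingularities.ResolutionOfSingularities.Theorems.HomologicalConductorPersistenceMonomialValuation
import Summits.ResolutionOfSingularities.ResolutionOfSingularities.Theorems.HomologicalConductorPersistenceKC3Tower

/-!
# Crux `Persistence` (stmt-ResolutionOfSingularities-16484), chain W4.4b — K-C3 K4c (the instance):
# `x = a⁶ ∉ s̲ann_{T₁}(X_b ⊗ T₁)` at the tower stage `T₁ = loc O W`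

Route `ResolutionOfSingularities/HomologicalConductor`.  OURS (cell res-hironaka, crux chain W4.4b,
K-C3-REPRO.md 40352614fdfe8abf §3 (the witness) / §7 K4c; CHAIN v13.3 ASSIGN v1.9 «058: K4a/b; then
K4c with 043/021»; seat res-D-pv-058); nothing here is a statement of the manuscript under review
(Hironaka 2017); AI-written, weaker than expert review.

Setting (KC3 SPELLING v1.1): `K = FractionRing k[X₀,X₁,X₂] = k(x,z,t)`, `O = monomialValuationRing k
(kc3Weight 1) K` (the `(6,5,4)`-monomial valuation ring, res-type-084's K3a), `W = k[x, z, t, z²x⁻¹,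
ztx⁻¹, t²x⁻¹, z³x⁻¹x⁻¹]` (spelled EXACTLY as in `…PersistenceKC3TowerInstance.kc3_tower_one_eq` /
`…PersistenceKC3ChartClosedForm`), `T₁ = ↥(loc O W)` (res-D-pv-043's K3b: `loc O W = {a s⁻¹ : a, s ∈ W,
s⁻¹ ∈ O}` and `tower O A 1 = loc O W`).

* §1 the DICTIONARY `dict : x ↦ a⁶, z ↦ a⁴b, t ↦ a³c` on `k[x,z,t]` (an injective `k`-algebra
  endomorphism of `k[X₀,X₁,X₂]`; on exponents `dictExp (i,j,l) = (6i+4j+3l, j, l)`), and the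
  divisibility `dict g = X₀^{6m} · q`, `q(0) = coeff_{x^m} g`, for `6m ≤ ν_{(6,4,3)}(g)`;
* §2 its extension `dictFrac : K →+* K` and `dictFrac (g · x⁻ᵐ) = q`;
* §3 DENOMINATORS: for `s = g · x⁻ᵐ ∈ W` with `s⁻¹ ∈ O`, `coeff_{x^m} g ≠ 0` (the `(6,5,4)`-value of
  `s` is `≥ 0` only through the monomial `x^m`), hence every element of `dictFrac (loc O W)` is `w / s`
  with `w, s ∈ k[a,b,c]`, `s(0) ≠ 0` (`exists_denominator`);
* §4 the `W`-presentation `kc3DLoc : Matrix (Fin 8) (Fin 12) T₁` of `X_b ⊗ T₁` — the matrix `kc3D`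
  (K-C3-REPRO §3) read through the dictionary: entries `zt/x, z²/x, z, t, x, t²/x, z³/x², z³t²/x³,
  z⁴t/x³, z²t²/x², z³t/x², z²t/x, −1` — with `kc3DLoc.map dictLoc = kc3D` for `dictLoc = dictFrac ∘ incl`;
* §5 **`not_stablyAnnihilates_xLoc`**: `x` does NOT stably annihilate `coker kc3DLoc = T₁⁸ ⧸ kc3DLoc·T₁¹²`
  over `T₁` — `KC3WitnessTransport.not_stablyAnnihilates_coker_of_transport` (K4c abstract) fed with
  §2–§4.  With `x ∈ cond(T₁/T₀)` (K2) and `coker kc3DLoc` MCM over `(T₁)_𝔪` (K-C3-REPRO §2, a K5 socket)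
  this is the LOSS `cond ⊄ ca` at the K-C3 blow-up.
[OURS; elementary.]
-/

noncomputable section

-- single-problem summit: the doubled namespace component `ResolutionOfSingularities` is forced
set_option linter.dupNamespace false

open CategoryTheory MvPolynomial WithZero
open Literature.AlgebraicGeometry.Resolution.WeightedBlowup
open Summit.ResolutionOfSingularities.ResolutionOfSingularities.Theorems.NoZeno.SandwichCluster
open Summit.ResolutionOfSingularities.ResolutionOfSingularities.Theorems.NoZeno.Birth
open Summit.ResolutionOfSingularities.ResolutionOfSingularities.Theorems.HomologicalConductor.KC3Witness
open Summit.ResolutionOfSingularities.ResolutionOfSingularities.Theorems.HomologicalConductor.KC3WitnessTransport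
open Summit.ResolutionOfSingularities.ResolutionOfSingularities.Theorems.HomologicalConductor.PersistenceKC3ChartClosedForm
open Summit.ResolutionOfSingularities.ResolutionOfSingularities.Theorems.HomologicalConductor.PersistenceMonomialValuation
open Summit.ResolutionOfSingularities.ResolutionOfSingularities.Theorems.HomologicalConductor.PersistenceKC3Tower

namespace Summit.ResolutionOfSingularities.ResolutionOfSingularities.Theorems.HomologicalConductor.KC3WitnessLocal

variable {k : Type} [Field k]

/-! ## §1 The dictionary `x ↦ a⁶, z ↦ a⁴b, t ↦ a³c` on polynomials -/

/-- The dictionary on exponents: `x^i z^j t^l ↦ a^{6i+4j+3l} b^j c^l`. [OURS · K-C3-REPRO §3] -/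
def dictExp (d : Fin 3 →₀ ℕ) : Fin 3 →₀ ℕ := e (6 * d 0 + 4 * d 1 + 3 * d 2) (d 1) (d 2)

/-- `dictExp` on `e i q r`. [OURS] -/
theorem dictExp_e (i q r : ℕ) : dictExp (e i q r) = e (6 * i + 4 * q + 3 * r) q r := by
  simp [dictExp]

/-- `dictExp` is injective. [OURS] -/
theorem dictExp_injective : Function.Injective dictExp := by
  intro d d' h
  have h0 := congrArg (fun f => f 0) h
  have h1 := congrArg (fun f => f 1) h
  have h2 := congrArg (fun f => f 2) h
  simp only [dictExp, e_apply_zero, e_apply_one, e_apply_two] at h0 h1 h2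
  have h0' : d 0 = d' 0 := by omega
  ext i
  fin_cases i
  · exact h0'
  · exact h1
  · exact h2

/-- **The dictionary** `dict : k[x,z,t] → k[a,b,c]`, `x ↦ a⁶, z ↦ a⁴b, t ↦ a³c` (both rings spelled
`MvPolynomial (Fin 3) k`). [OURS · K-C3-REPRO §3] -/
def dict : MvPolynomial (Fin 3) k →ₐ[k] MvPolynomial (Fin 3) k :=
  aeval ![X 0 ^ 6, X 0 ^ 4 * X 1, X 0 ^ 3 * X 2]

/-- `dict` on monomials. [OURS] -/
theorem dict_monomial (d : Fin 3 →₀ ℕ) (c : k) :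
    dict (monomial d c) = monomial (dictExp d) c := by
  rw [dict, aeval_monomial, Finsupp.prod_fintype _ _ (fun i => by simp), Fin.prod_univ_three, monomial_eq,
    Finsupp.prod_fintype _ _ (fun i => by simp), Fin.prod_univ_three, algebraMap_eq]
  simp only [Matrix.cons_val_zero, Matrix.cons_val_one, Matrix.cons_val, dictExp, e_apply_zero, e_apply_one,
    e_apply_two]
  ring

/-- `dict x = a⁶`. [OURS] -/
theorem dict_X_zero : dict (X 0 : MvPolynomial (Fin 3) k) = X 0 ^ 6 := by
  simp [dict]

/-- `coeff_{dictExp d} (dict p) = coeff_d p`. [OURS] -/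
theorem coeff_dictExp_dict (d : Fin 3 →₀ ℕ) (p : MvPolynomial (Fin 3) k) :
    coeff (dictExp d) (dict p) = coeff d p := by
  conv_lhs => rw [p.as_sum, map_sum]
  simp only [dict_monomial, coeff_sum, coeff_monomial]
  rw [Finset.sum_eq_single d]
  · rw [if_pos rfl]
  · intro d' _ hne
    rw [if_neg fun h => hne (dictExp_injective h)]
  · intro hd
    rw [if_pos rfl, notMem_support_iff.mp hd]

/-- `dict` is injective. [OURS] -/
theorem dict_injective : Function.Injective (dict : MvPolynomial (Fin 3) k → MvPolynomial (Fin 3) k) := by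
  intro p q h
  ext d
  rw [← coeff_dictExp_dict d p, ← coeff_dictExp_dict d q, h]

/-- The weighted order `6m ≤ ν_{(6,4,3)}(g)` makes `dict g` divisible by `a^{6m}`, with quotient `q`,
`q(0) = coeff_{x^m} g`. [OURS · K-C3-REPRO §7 K4c] -/
theorem exists_dict_eq_mul (g : MvPolynomial (Fin 3) k) (m : ℕ)
    (hw : ((6 * m : ℕ) : ℕ∞) ≤ monomialOrd (![6, 4, 3] : Fin 3 → ℕ) g) :
    ∃ q : MvPolynomial (Fin 3) k, dict g = X 0 ^ (6 * m) * q ∧ coeff 0 q = coeff (Finsupp.single 0 m) g := by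
  rw [le_monomialOrd_iff_weight] at hw
  refine ⟨∑ d ∈ g.support, monomial (dictExp d - Finsupp.single 0 (6 * m)) (coeff d g), ?_, ?_⟩
  · conv_lhs => rw [g.as_sum, map_sum]
    rw [Finset.mul_sum]
    refine Finset.sum_congr rfl fun d hd => ?_
    rw [dict_monomial, X_pow_eq_monomial, monomial_mul, one_mul, add_tsub_cancel_of_le]
    rw [Finsupp.single_le_iff]
    show 6 * m ≤ dictExp d 0
    rw [dictExp, e_apply_zero]
    exact hw d hd
  · rw [coeff_sum]
    simp only [coeff_monomial]
    rw [Finset.sum_eq_single (Finsupp.single 0 m)]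
    · rw [if_pos]
      rw [tsub_eq_zero_iff_le, Finsupp.le_def]
      intro i
      fin_cases i <;> simp [dictExp]
    · intro d hd hne
      rw [if_neg]
      intro h0
      apply hne
      rw [tsub_eq_zero_iff_le, Finsupp.le_def] at h0
      have h00 := h0 0
      have h01 := h0 1
      have h02 := h0 2
      have hwd := hw d hd
      simp only [dictExp, e_apply_zero, e_apply_one, e_apply_two, Finsupp.single_apply] at h00 h01 h02
      simp at h00 h01 h02
      ext i
      fin_cases i
      · simp; omega
      · simp; omega
      · simp; omega
    · intro h
      rw [notMem_support_iff.mp h, if_pos]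
      rw [tsub_eq_zero_iff_le, Finsupp.le_def]
      intro i
      fin_cases i <;> simp [dictExp]

/-! ## §2 The dictionary on `K = k(x,z,t)` -/

local notation3 "𝕂" => FractionRing (MvPolynomial (Fin 3) k)
local notation3 "ι" => algebraMap (MvPolynomial (Fin 3) k) (FractionRing (MvPolynomial (Fin 3) k))
local notation3 "𝔵" => algebraMap (MvPolynomial (Fin 3) k) (FractionRing (MvPolynomial (Fin 3) k)) (MvPolynomial.X 0)
local notation3 "𝔷" => algebraMap (MvPolynomial (Fin 3) k) (FractionRing (MvPolynomial (Fin 3) k)) (MvPolynomial.X 1)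
local notation3 "𝔱" => algebraMap (MvPolynomial (Fin 3) k) (FractionRing (MvPolynomial (Fin 3) k)) (MvPolynomial.X 2)
/-- The chart ring `W` — spelled EXACTLY as in `…PersistenceKC3ChartClosedForm` / `…KC3TowerInstance.kc3_tower_one_eq`
(local notation only). -/
local notation3 "𝕎" => Algebra.adjoin k
  ({algebraMap (MvPolynomial (Fin 3) k) (FractionRing (MvPolynomial (Fin 3) k)) (MvPolynomial.X 0),
    algebraMap (MvPolynomial (Fin 3) k) (FractionRing (MvPolynomial (Fin 3) k)) (MvPolynomial.X 1),
    algebraMap (MvPolynomial (Fin 3) k) (FractionRing (MvPolynomial (Fin 3) k)) (MvPolynomial.X 2),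
    algebraMap (MvPolynomial (Fin 3) k) (FractionRing (MvPolynomial (Fin 3) k)) (MvPolynomial.X 1) ^ 2 *
      (algebraMap (MvPolynomial (Fin 3) k) (FractionRing (MvPolynomial (Fin 3) k)) (MvPolynomial.X 0))⁻¹,
    algebraMap (MvPolynomial (Fin 3) k) (FractionRing (MvPolynomial (Fin 3) k)) (MvPolynomial.X 1) *
      algebraMap (MvPolynomial (Fin 3) k) (FractionRing (MvPolynomial (Fin 3) k)) (MvPolynomial.X 2) *
      (algebraMap (MvPolynomial (Fin 3) k) (FractionRing (MvPolynomial (Fin 3) k)) (MvPolynomial.X 0))⁻¹,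
    algebraMap (MvPolynomial (Fin 3) k) (FractionRing (MvPolynomial (Fin 3) k)) (MvPolynomial.X 2) ^ 2 *
      (algebraMap (MvPolynomial (Fin 3) k) (FractionRing (MvPolynomial (Fin 3) k)) (MvPolynomial.X 0))⁻¹,
    algebraMap (MvPolynomial (Fin 3) k) (FractionRing (MvPolynomial (Fin 3) k)) (MvPolynomial.X 1) ^ 3 *
      (algebraMap (MvPolynomial (Fin 3) k) (FractionRing (MvPolynomial (Fin 3) k)) (MvPolynomial.X 0))⁻¹ *
      (algebraMap (MvPolynomial (Fin 3) k) (FractionRing (MvPolynomial (Fin 3) k)) (MvPolynomial.X 0))⁻¹} :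
    Set (FractionRing (MvPolynomial (Fin 3) k)))
/-- The `(6,5,4)`-monomial valuation ring `O ⊆ K` (res-type-084's K3a; local notation only). -/
local notation3 "𝕆" => monomialValuationRing k (kc3Weight 1) (FractionRing (MvPolynomial (Fin 3) k))

/-- `ι ∘ dict` is injective. [OURS] -/
theorem algebraMap_comp_dict_injective :
    Function.Injective ((algebraMap (MvPolynomial (Fin 3) k) 𝕂).comp (dict (k := k)).toRingHom) :=
  (IsFractionRing.injective _ _).comp dict_injective

/-- **The dictionary on `K`**: the field map `k(x,z,t) → k(a,b,c)`, `x ↦ a⁶, z ↦ a⁴b, t ↦ a³c` (both fields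
spelled `FractionRing (MvPolynomial (Fin 3) k)`). [OURS · K-C3-REPRO §3] -/
def dictFrac : 𝕂 →+* 𝕂 := IsFractionRing.lift (algebraMap_comp_dict_injective (k := k))

/-- `dictFrac (ι p) = ι (dict p)`. [OURS] -/
theorem dictFrac_algebraMap (p : MvPolynomial (Fin 3) k) : dictFrac (ι p) = ι (dict p) :=
  IsFractionRing.lift_algebraMap _ p

/-- `dictFrac x = a⁶`. [OURS] -/
theorem dictFrac_x : dictFrac (𝔵 : 𝕂) = ι (X 0 ^ 6) := by
  rw [dictFrac_algebraMap, dict_X_zero]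

/-- `dictFrac (g · x⁻ᵐ) = q ∈ k[a,b,c]` with `q(0) = coeff_{x^m} g`, for `6m ≤ ν_{(6,4,3)}(g)`. [OURS · K-C3-REPRO §7] -/
theorem dictFrac_laurent (g : MvPolynomial (Fin 3) k) (m : ℕ)
    (hw : ((6 * m : ℕ) : ℕ∞) ≤ monomialOrd (![6, 4, 3] : Fin 3 → ℕ) g) :
    ∃ q : MvPolynomial (Fin 3) k, coeff 0 q = coeff (Finsupp.single 0 m) g ∧ dictFrac (ι g * 𝔵⁻¹ ^ m) = ι q := by
  obtain ⟨q, hq, hq0⟩ := exists_dict_eq_mul g m hw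
  refine ⟨q, hq0, ?_⟩
  rw [map_mul, map_pow, map_inv₀, dictFrac_algebraMap, hq, dictFrac_x, map_mul, map_pow, map_pow, inv_pow,
    ← pow_mul]
  have hx : (𝔵 : 𝕂) ≠ 0 := x_ne_zero
  rw [mul_comm (𝔵 ^ (6 * m)) (ι q), mul_assoc, mul_inv_cancel₀ (pow_ne_zero _ hx), mul_one]

/-! ## §3 Denominators of `loc O W` have a unit constant term under the dictionary -/

/-- `weight (6,5,4) d = 6 d₀ + 5 d₁ + 4 d₂`. [folklore] -/
theorem weight_kc3_eq (d : Fin 3 →₀ ℕ) : Finsupp.weight (kc3Weight 1) d = 6 * d 0 + 5 * d 1 + 4 * d 2 := by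
  rw [Finsupp.weight_apply, Finsupp.sum_fintype _ _ (by simp)]
  simp only [Fin.sum_univ_three, smul_eq_mul, kc3Weight_zero, kc3Weight_one, kc3Weight_two]
  ring

/-- **The denominator lemma.** If `s = g · x⁻ᵐ ∈ W` (`6m ≤ ν_{(6,4,3)}(g)`, `g ≠ 0`) has `s⁻¹ ∈ O` (the
`(6,5,4)`-value of `s` is `≤ 0`), then the monomial `x^m` occurs in `g`: `coeff_{x^m} g ≠ 0`. (Every monomial
`x^a z^b t^c` of `g` has `6a+5b+4c ≥ 6a+4b+3c ≥ 6m` with equality only for `x^m`.) [OURS · K-C3-REPRO §7 K4c] -/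
theorem coeff_ne_zero_of_inv_mem (g : MvPolynomial (Fin 3) k) (m : ℕ)
    (hw : ((6 * m : ℕ) : ℕ∞) ≤ monomialOrd (![6, 4, 3] : Fin 3 → ℕ) g) (hg : g ≠ 0)
    (hO : (ι g * 𝔵⁻¹ ^ m)⁻¹ ∈ 𝕆) : coeff (Finsupp.single 0 m) g ≠ 0 := by
  rw [le_monomialOrd_iff_weight] at hw
  obtain ⟨d, hd, hdw⟩ := exists_weight_eq_monomialOrd (kc3Weight 1) hg
  rw [mem_monomialValuationRing_iff, map_inv₀, map_mul, map_pow, map_inv₀, monomialValuationFrac_algebraMap,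
    monomialValuationFrac_X, monomialValuation_apply, ← hdw, expNeg_coe, kc3Weight_zero, ← exp_neg, ← exp_nsmul,
    ← exp_add, ← exp_neg, ← exp_zero, exp_le_exp, weight_kc3_eq] at hO
  simp only [nsmul_eq_mul, neg_neg, Nat.cast_ofNat, neg_add_rev, Nat.cast_add, Nat.cast_mul] at hO
  have hwd := hw d hd
  have hd_eq : d = Finsupp.single 0 m := by
    ext i
    fin_cases i
    · simp; omega
    · simp; omega
    · simp; omega
  rw [← hd_eq]
  exact mem_support_iff.mp hd

/-- `W ⊆ loc O W`. [folklore] -/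
theorem mem_loc_of_mem {y : 𝕂} (hy : y ∈ 𝕎) : y ∈ loc 𝕆 𝕎 :=
  (mem_loc_iff 𝕆 𝕎).mpr ⟨y, hy, 1, Subalgebra.one_mem _, by rw [inv_one]; exact one_mem _, by rw [inv_one, mul_one]⟩

/-- **Denominators.** Every element of `dictFrac (loc O W)` is `w / s` with `w, s ∈ k[a,b,c]`, `s(0) ≠ 0`:
`e = a s⁻¹`, `a = g_a x^{-m_a}`, `s = g_s x^{-m_s}` (closed form of `W`), `dictFrac a = q_a`, `dictFrac s = q_s`
with `q_s(0) = coeff_{x^{m_s}} g_s ≠ 0` by the denominator lemma. [OURS · K-C3-REPRO §7 K4c] -/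
theorem exists_denominator {y : 𝕂} (hy : y ∈ loc 𝕆 𝕎) :
    ∃ w s : MvPolynomial (Fin 3) k, coeff 0 s ≠ 0 ∧ dictFrac y * ι s = ι w := by
  obtain ⟨a, ha, s, hs, hsO, rfl⟩ := (mem_loc_iff 𝕆 𝕎).mp hy
  obtain ⟨ga, ma, hwa, rfl⟩ := (mem_W_iff a).mp ha
  obtain ⟨gs, ms, hws, rfl⟩ := (mem_W_iff _).mp hs
  by_cases hgs : gs = 0
  · refine ⟨0, 1, by simp, ?_⟩
    simp [hgs]
  obtain ⟨qa, -, hqa⟩ := dictFrac_laurent ga ma hwa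
  obtain ⟨qs, hqs0, hqs⟩ := dictFrac_laurent gs ms hws
  have hc : coeff (Finsupp.single 0 ms) gs ≠ 0 := coeff_ne_zero_of_inv_mem gs ms hws hgs hsO
  rw [← hqs0] at hc
  have hqs_ne : (ι qs : 𝕂) ≠ 0 := by
    intro h
    apply hc
    rw [(IsFractionRing.injective (MvPolynomial (Fin 3) k) 𝕂) (h.trans (map_zero _).symm), coeff_zero]
  refine ⟨qa, qs, hc, ?_⟩
  rw [map_mul, map_inv₀, hqa, hqs, inv_mul_cancel_right₀ hqs_ne]

/-! ## §4 The `W`-presentation of `X_b` over `T₁ = loc O W` -/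

/-- A Laurent monomial `c · x^i z^q t^r · x⁻ᵐ` of non-negative weight lies in `loc O W`. [OURS] -/
theorem laurent_mem (i q r m : ℕ) (c : k) (h : 6 * m ≤ 6 * i + 4 * q + 3 * r) :
    ι (monomial (e i q r) c) * 𝔵⁻¹ ^ m ∈ loc 𝕆 𝕎 := by
  refine mem_loc_of_mem (mem_of_laurent _ m ?_)
  by_cases hc : c = 0
  · simp [hc, monomialOrd_zero]
  · rw [monomialOrd_monomial _ _ hc, weight_eq, Nat.cast_le]
    simpa using h

/-- The entry constructor: `lT i q r m c _ = c · x^i z^q t^r x⁻ᵐ ∈ T₁`. [OURS] -/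
def lT (i q r m : ℕ) (c : k) (h : 6 * m ≤ 6 * i + 4 * q + 3 * r) : ↥(loc 𝕆 𝕎) :=
  ⟨ι (monomial (e i q r) c) * 𝔵⁻¹ ^ m, laurent_mem i q r m c h⟩

/-- The dictionary on the entries: `dictFrac (c x^i z^q t^r x⁻ᵐ) = c a^{6i+4q+3r−6m} b^q c^r`. [OURS] -/
theorem dictFrac_lT (i q r m : ℕ) (c : k) (h : 6 * m ≤ 6 * i + 4 * q + 3 * r) :
    dictFrac ((lT i q r m c h : ↥(loc 𝕆 𝕎)) : 𝕂) = ι (monomial (e (6 * i + 4 * q + 3 * r - 6 * m) q r) c) := by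
  simp only [lT]
  rw [map_mul, map_pow, map_inv₀, dictFrac_algebraMap, dict_monomial, dictExp_e, dictFrac_x]
  have hx : (𝔵 : 𝕂) ≠ 0 := x_ne_zero
  have hmon : (monomial (e (6 * i + 4 * q + 3 * r) q r) c : MvPolynomial (Fin 3) k) =
      (X 0 ^ 6) ^ m * monomial (e (6 * i + 4 * q + 3 * r - 6 * m) q r) c := by
    rw [← pow_mul, X_pow_eq_monomial, monomial_mul, one_mul]
    have he : Finsupp.single (0 : Fin 3) (6 * m) = e (6 * m) 0 0 := by
      simp [e]
    rw [he, e_add, zero_add, zero_add, Nat.add_sub_cancel' h]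
  rw [hmon, map_mul, map_pow, mul_comm (ι (X 0 ^ 6) ^ m), mul_assoc, ← mul_pow,
    mul_inv_cancel₀ (by rw [map_pow]; exact pow_ne_zero _ hx), one_pow, mul_one]

/-- **The presentation matrix of `X_b ⊗ T₁` over `T₁ = loc O W`** (K-C3-REPRO §3, rows = generators
`g₁…g₈`, columns = relations `r₁…r₁₂`): the matrix `KC3Witness.kc3D` with every entry `a^p b^q c^r`
written as the chart element `x^i z^q t^r x⁻ᵐ` (`6i − 6m + 4q + 3r = p`): `abc = zt/x`, `a²b² = z²/x`,
`a⁴b = z`, `a³c = t`, `a⁶ = x`, `c² = t²/x`, `b³ = z³/x²`, `b³c² = z³t²/x³`, `ab⁴c = z⁴t/x³`,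
`a²b²c² = z²t²/x²`, `a³b³c = z³t/x²`, `a⁵b²c = z²t/x`. [OURS · K-C3-REPRO §3] -/
def kc3DLoc : Matrix (Fin 8) (Fin 12) ↥(loc 𝕆 𝕎) :=
  Matrix.of ![
    ![lT 0 1 1 1 1 (by norm_num), lT 0 2 0 1 1 (by norm_num), lT 0 1 0 0 1 (by norm_num),
      lT 0 0 1 0 1 (by norm_num), lT 0 1 0 0 1 (by norm_num), lT 1 0 0 0 1 (by norm_num), 0, 0, 0, 0,
      lT 0 3 0 2 (-1) (by norm_num), 0],
    ![lT 0 0 2 1 (-1) (by norm_num), lT 0 1 1 1 (-1) (by norm_num), lT 0 0 1 0 (-1) (by norm_num), 0, 0, 0,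
      lT 0 2 0 1 1 (by norm_num), lT 0 0 1 0 1 (by norm_num), lT 0 1 0 0 1 (by norm_num),
      lT 1 0 0 0 1 (by norm_num), 0, lT 0 0 0 0 (-1) (by norm_num)],
    ![0, 0, 0, lT 0 0 2 1 (-1) (by norm_num), lT 0 1 1 1 (-1) (by norm_num), lT 0 0 1 0 (-1) (by norm_num),
      lT 0 3 0 2 (-1) (by norm_num), lT 0 1 1 1 (-1) (by norm_num), lT 0 2 0 1 (-1) (by norm_num),
      lT 0 1 0 0 (-1) (by norm_num), 0, 0],
    ![0, 0, 0, 0, 0, 0, 0, 0, 0, 0, lT 0 3 2 3 1 (by norm_num), lT 0 1 1 1 1 (by norm_num)],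
    ![0, 0, 0, 0, 0, 0, 0, 0, 0, 0, lT 0 4 1 3 1 (by norm_num), lT 0 2 0 1 1 (by norm_num)],
    ![0, 0, 0, 0, 0, 0, 0, 0, 0, 0, lT 0 2 2 2 1 (by norm_num), lT 0 0 1 0 1 (by norm_num)],
    ![0, 0, 0, 0, 0, 0, 0, 0, 0, 0, lT 0 3 1 2 1 (by norm_num), lT 0 1 0 0 1 (by norm_num)],
    ![0, 0, 0, 0, 0, 0, 0, 0, 0, 0, lT 0 2 1 1 1 (by norm_num), lT 1 0 0 0 1 (by norm_num)]]

/-- **`x ∈ T₁`** — the element `x = ι X₀` of the stage ring `loc O W`. [OURS] -/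
def xLoc : ↥(loc 𝕆 𝕎) := ⟨𝔵, mem_loc_of_mem (Algebra.subset_adjoin (by simp))⟩

/-- `xLoc` is `x`. [OURS] -/
@[simp] theorem coe_xLoc : ((xLoc : ↥(loc 𝕆 𝕎)) : 𝕂) = 𝔵 := rfl

/-- The transport map `Φ = dictLoc = dictFrac ∘ (loc O W ↪ K)`. [OURS] -/
def dictLoc : ↥(loc 𝕆 𝕎) →+* 𝕂 := (dictFrac (k := k)).comp (loc 𝕆 𝕎).val.toRingHom

/-- `dictLoc y = dictFrac y`. [OURS] -/
@[simp] theorem dictLoc_apply (y : ↥(loc 𝕆 𝕎)) : dictLoc y = dictFrac (y : 𝕂) := rfl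

/-- **`Φ (kc3DLoc) = kc3D`**: the `T₁`-matrix is the witness matrix read through the dictionary. [OURS · K-C3-REPRO §3] -/
theorem kc3DLoc_map : (kc3DLoc (k := k)).map dictLoc = (kc3D k).map ι := by
  ext g r
  rw [Matrix.map_apply, Matrix.map_apply, dictLoc_apply]
  fin_cases g <;> fin_cases r <;>
    first
      | exact (map_zero _).trans (map_zero _).symm
      | exact dictFrac_lT _ _ _ _ _ (by norm_num)

/-! ## §5 K4c: `x ∉ s̲ann_{T₁}(X_b ⊗ T₁)` -/

set_option synthInstance.maxHeartbeats 100000 in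
-- instance search through the (large) subalgebra term `loc O W` needs ≈ 3× the default budget
/-- **K-C3 K4c.** Over the tower stage `T₁ = loc O W` (`K = k(x,z,t)`, `O` the `(6,5,4)`-monomial valuation
ring, `W = k[x,z,t,z²/x,zt/x,t²/x,z³/x²]`), the element `x` does NOT stably annihilate
`coker kc3DLoc = T₁⁸ ⧸ kc3DLoc · T₁¹² = X_b ⊗_W T₁`: `KC3WitnessTransport.not_stablyAnnihilates_coker_of_transport`
with `Φ = dictLoc = dictFrac ∘ incl` (`Φ(kc3DLoc) = kc3D`, `Φ x = a⁶`), denominators from `exists_denominator`, and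
injectivity of `k[a,b,c] → k(a,b,c)`.  Since `x ∈ cond(T₁/T₀)` (K2), once `X_b ⊗ T₁` is known MCM at the
vertex this is `cond(T₁/T₀) ⊄ ca(T₁)` — the K-C3 kill of `Persistence` (K5). [OURS · K-C3-REPRO §7 K4c] -/
theorem not_stablyAnnihilates_xLoc :
    ¬ StablyAnnihilates ↥(loc 𝕆 𝕎) xLoc
      (ModuleCat.of ↥(loc 𝕆 𝕎) ((Fin 8 → ↥(loc 𝕆 𝕎)) ⧸ LinearMap.range (kc3DLoc (k := k)).mulVecLin)) :=
  not_stablyAnnihilates_coker_of_transport (k := k) (L := 𝕂) dictLoc (IsFractionRing.injective _ _) kc3DLoc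
    kc3DLoc_map xLoc (by rw [dictLoc_apply, coe_xLoc, dictFrac_x]) fun y => exists_denominator y.2

end Summit.ResolutionOfSingularities.ResolutionOfSingularities.Theorems.HomologicalConductor.KC3WitnessLocal

end
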